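import Summits.BirchSwinnertonDyer.BirchSwinnertonDyer.Theorems.ManinLocalTwoThreeManinConstantOneTwentySix
import Summits.BirchSwinnertonDyer.BirchSwinnertonDyer.Theorems.ManinLocalTwoThreeDyadicTwistFamiliesFactFree
import Summits.BirchSwinnertonDyer.BirchSwinnertonDyer.Theorems.ManinLocalTwoThreeNotTrivialEisensteinModThreeMultiplicativeUnconditional
import HarnessLib

/-!
# The ADDITIVE root `126 = 2·3²·7` for the fact-free twist families: `LevelManinOne 126`, its odd and dyadic twist images, and the
# crux shapes at `2016 = 2⁵·3²·7` (C2 ∧ C3), `8064`, `882`, `3150`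

Cell bsd-f2-manin, route `ManinLocalTwoThree` (cruxes C2 `ManinOddAtFour` stmt-22967 / C3 `ManinPrimeToThreeAtNine` stmt-22968),
prover seat p3 gen 26; the level-`126` twin of `…TwistRootsFortyTwo`.  `LevelOneTwentySix.abs_maninConstant_eq_one_oneTwentySix` (this
seat: an g55's pinning + rows, the odd-twist ROOT-FORM transport from the fact-free roots `14` / `42`) is verbatim `LevelManinOne 126` —
the FIRST additive-at-`3` level (`9 ∥ N`) fed to the tree's twist engines as a ROOT: THEOREMS 68.A–C / 69.A–C turn it into `|c| = 1` on
the twist images of the classes `126a`, `126b`: `⊗ χ₋₄` (`N = 2016 = 2⁵·3²·7`, in BOTH crux domains), `⊗ χ±8` (`8064 = 2⁷·3²·7`),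
`⊗ χ₋₇` (`882 = 2·3²·7²`), `⊗ χ₅` (`3150 = 2·3²·5²·7`), … .  The carrier of an `X₀(126)`-datum is MULTIPLICATIVE at `2` with no
hypothesis (`hasMultiplicativeReductionAtPrime_two`: `2 ∥ 126` for the newform, Atkin–Lehner `a₂² = 1`), so Stevens' `η`-clause of the
dyadic engine is discharged.

HONEST SCOPE.  The statements cover exactly the twist images of level `126` (hypotheses as in the engines: a root datum at `126`, the
member additive at `2` resp. the coefficient identity).  Nothing here proves C2, C3 (∀ N), the rung, Manin's conjecture or BSD; items
22967/22968 stay OPEN.  No definition, no named fact, no sorry.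
[cite: Stevens1989, Lemma (5.2), (5.4), (5.6)–(5.7)] [cite: Pal2012, Prop. 2.4] [cite: AtkinLehner1970, Thm. 3]
[cite: CremonaAlgorithms1997, Table 1 (126a1, 126b1, 882, 2016)]
-/

set_option autoImplicit false
-- lint-debt: the directory name repeats the summit name (sibling precedent `ManinLocalTwoThreeTwistRootsFortyTwo.lean`)
set_option linter.dupNamespace false

noncomputable section

open Complex
open scoped MatrixGroups ModularForm
open ModularForm CongruenceSubgroup
open Literature.NumberTheory.EllipticCurves Literature.NumberTheory.EllipticCurves.ModularForms
open Summit.BirchSwinnertonDyer.BirchSwinnertonDyer.Theorems.ManinLocalTwoThree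

namespace Summit.BirchSwinnertonDyer.BirchSwinnertonDyer.Theorems.ManinLocalTwoThree.TwistRootsOneTwentySix

open WeierstrassCurve TwistFamilies DyadicTwistFamilies

/-! ## §1 The root and its families -/

/-- **`LevelManinOne 126`** — level `126 = 2·3²·7` (additive at `3`, genus `17`, classes `126a = 14a ⊗ χ₋₃`, `126b = 42a ⊗ χ₋₃`) is
COMPLETE, fact-free (p3 g26: odd-twist root-form transport). [cite: CremonaAlgorithms1997, Table 1 (126a1, 126b1)] -/
theorem levelManinOne_oneTwentySix : LevelManinOne 126 :=
  fun W _ _ D h ↦ LevelOneTwentySix.abs_maninConstant_eq_one_oneTwentySix W D h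

/-- **Every curve carrying an `X₀(126)`-datum is MULTIPLICATIVE at `2`** — no hypothesis (`2 ∥ 126` for the newform; Atkin–Lehner
`a₂(f)² = 1`, so `a₂(W) ≠ 0`). [cite: AtkinLehner1970, Thm. 3] -/
theorem hasMultiplicativeReductionAtPrime_two {W : WeierstrassCurve ℚ} [W.IsElliptic] (D : ModularParametrizationData W 126) :
    haveI : Fact (Nat.Prime 2) := ⟨Nat.prime_two⟩
    W.HasMultiplicativeReductionAtPrime 2 :=
  haveI : Fact (Nat.Prime 2) := ⟨Nat.prime_two⟩
  NotTrivialEisensteinUnconditional.hasMultiplicativeReductionAtPrime_of_isNewformOf_of_dvd_of_not_sq_dvd W D.isNewformOf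
    (q := 2) ⟨63, rfl⟩ (by decide)

/-- **Every curve carrying an `X₀(126)`-datum is MULTIPLICATIVE at `7`** — no hypothesis (`7 ∥ 126`). [cite: AtkinLehner1970, Thm. 3] -/
theorem hasMultiplicativeReductionAtPrime_seven {W : WeierstrassCurve ℚ} [W.IsElliptic] (D : ModularParametrizationData W 126) :
    haveI : Fact (Nat.Prime 7) := ⟨by norm_num⟩
    W.HasMultiplicativeReductionAtPrime 7 :=
  haveI : Fact (Nat.Prime 7) := ⟨by norm_num⟩
  NotTrivialEisensteinUnconditional.hasMultiplicativeReductionAtPrime_of_isNewformOf_of_dvd_of_not_sq_dvd W D.isNewformOf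
    (q := 7) ⟨18, rfl⟩ (by decide)

/-- **`TwistLevelManinOne 126 p` for every odd prime `p`** (THEOREM 68.A on the root `126`): `|c| = 1` on the `χ_p`-twist image of
level `126` (root datum good or multiplicative at `p`; at `p = 7` the level `882 = 2·3²·7²`, else `126p²`). [cite: Stevens1989, Lemma (5.2), (5.4)] -/
theorem twistLevelManinOne_oneTwentySix {p : ℕ} [Fact p.Prime] (hp2 : p ≠ 2) : TwistLevelManinOne 126 p :=
  twistLevelManinOne_of_levelManinOne levelManinOne_oneTwentySix hp2

/-- **`DyadicTwistLevelManinOne 126 d`, `d ∈ {−1, 2, −2}`** (THEOREM 69.A on the root `126`): the levels `2016 = 2⁵·3²·7` (`⊗ χ₋₄`) and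
`8064 = 2⁷·3²·7` (`⊗ χ±8`), both in BOTH crux domains. [cite: Stevens1989, Lemma (5.6)–(5.7)] [cite: Pal2012, Prop. 2.4] -/
theorem dyadicTwistLevelManinOne_oneTwentySix {d : ℤ} (hd : d = -1 ∨ d = 2 ∨ d = -2) : DyadicTwistLevelManinOne 126 d :=
  dyadicTwistLevelManinOne_of_levelManinOne levelManinOne_oneTwentySix hd

/-- **Per-newform closure at the root `126`** (THEOREM 68.C): every `χ_p`-twist (`p` odd, the carrier good at `p`) of the newform of an
`X₀(126)`-datum has `NewformManinOne`. [cite: Stevens1989, Lemma (5.2), (5.4)] -/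
theorem newformManinOne_twist_oneTwentySix {p : ℕ} [Fact p.Prime] (hp2 : p ≠ 2)
    {χ : DirichletCharacter ℂ p} (hχ : χ.IsQuadratic) (hprim : χ.IsPrimitive)
    {W₀ : WeierstrassCurve ℚ} [W₀.IsElliptic] (D₀ : ModularParametrizationData W₀ 126)
    (hgood : W₀.HasGoodReductionAtPrime p)
    {N : ℕ} [NeZero N] (hMN : 126 ∣ N) (hpN : p ^ 2 ∣ N) (g' : CuspForm (Gamma0 N) 2)
    (hg' : ∀ n : ℕ, cuspCoeff g' n = χ n * cuspCoeff D₀.f n) : NewformManinOne g' :=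
  newformManinOne_twist_of_levelManinOne levelManinOne_oneTwentySix hp2 hχ hprim D₀ hgood hMN hpN g' hg'

/-! ## §2 The crux shapes on named members -/

/-- **C2 ∧ C3 on `126 ⊗ χ₋₄` (level `2016 = 2⁵·3²·7`)**: `|c(D')| = 1 ∧ 2 ∤ c(D') ∧ 3 ∤ c(D')` for every lattice-optimal `X₀(2016)`-datum
`D'` of a globally minimal `W'` additive at `2` and isogenous to the `−1`-twist of the carrier of a lattice-optimal `X₀(126)`-datum (the
carrier is multiplicative at `2` automatically).  No printed fact. [cite: CremonaAlgorithms1997, Table 1 (2016)] -/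
theorem shapes_on_family_oneTwentySix_negOne
    (W : WeierstrassCurve ℚ) [W.IsElliptic] [W.IsGloballyMinimal] (D : ModularParametrizationData W 126)
    (hopt : ∀ z ∈ D.L.lattice, ∃ w ∈ periodLattice D.f, z = D.c * w)
    (W' : WeierstrassCurve ℚ) [W'.IsElliptic] [W'.IsGloballyMinimal] [NeZero (2016 : ℕ)]
    (D' : ModularParametrizationData W' 2016)
    (htw : IsIsogenous W' (W.quadraticTwist ((-1 : ℤ) : ℚ)))
    (hadd' : ¬ W'.HasGoodReductionAtPrime 2 ∧ ¬ W'.HasMultiplicativeReductionAtPrime 2)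
    (hopt' : ∀ z ∈ D'.L.lattice, ∃ w ∈ periodLattice D'.f, z = D'.c * w) :
    |D'.maninConstant| = 1 ∧ ¬ (2 : ℤ) ∣ D'.maninConstant ∧ ¬ (3 : ℤ) ∣ D'.maninConstant :=
  shapes_of_dyadicTwistLevelManinOne (dyadicTwistLevelManinOne_oneTwentySix (Or.inl rfl)) W D hopt
    (Or.inr (hasMultiplicativeReductionAtPrime_two D)) (Or.inl rfl) W' 2016 D' (by norm_num) (by norm_num) htw hadd' hopt'

/-- **C2 ∧ C3 on `126 ⊗ χ±8` (level `8064 = 2⁷·3²·7`)** — Stevens' `η`-clause discharged by `hasMultiplicativeReductionAtPrime_two`.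
[cite: Stevens1989, Lemma (5.6)–(5.7)] -/
theorem shapes_on_family_oneTwentySix_two {d : ℤ} (hd : d = 2 ∨ d = -2)
    (W : WeierstrassCurve ℚ) [W.IsElliptic] [W.IsGloballyMinimal] (D : ModularParametrizationData W 126)
    (hopt : ∀ z ∈ D.L.lattice, ∃ w ∈ periodLattice D.f, z = D.c * w)
    (W' : WeierstrassCurve ℚ) [W'.IsElliptic] [W'.IsGloballyMinimal] [NeZero (8064 : ℕ)]
    (D' : ModularParametrizationData W' 8064)
    (htw : IsIsogenous W' (W.quadraticTwist (d : ℚ)))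
    (hadd' : ¬ W'.HasGoodReductionAtPrime 2 ∧ ¬ W'.HasMultiplicativeReductionAtPrime 2)
    (hopt' : ∀ z ∈ D'.L.lattice, ∃ w ∈ periodLattice D'.f, z = D'.c * w) :
    |D'.maninConstant| = 1 ∧ ¬ (2 : ℤ) ∣ D'.maninConstant ∧ ¬ (3 : ℤ) ∣ D'.maninConstant :=
  have hd3 : d = -1 ∨ d = 2 ∨ d = -2 := Or.inr hd
  have habs : (4 * d.natAbs) ^ 2 = 64 := by rcases hd with rfl | rfl <;> rfl
  shapes_of_dyadicTwistLevelManinOne (dyadicTwistLevelManinOne_oneTwentySix hd3) W D hopt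
    (Or.inr (hasMultiplicativeReductionAtPrime_two D)) (Or.inr (Or.inl (hasMultiplicativeReductionAtPrime_two D)))
    W' 8064 D' (by norm_num) (by rw [habs]; norm_num) htw hadd' hopt'

/-- **C3 (and `7 ∤ c`) on `126 ⊗ χ₋₇` (level `882 = 2·3²·7²`)**: `|c(D')| = 1 ∧ 3 ∤ c(D') ∧ 7 ∤ c(D')` for every lattice-optimal
`X₀(882)`-datum `D'` whose newform is the `χ`-twist (`χ` primitive quadratic mod `7`) of the newform of a lattice-optimal `X₀(126)`-datum
(the carrier is multiplicative at `7` automatically).  No printed fact. [cite: CremonaAlgorithms1997, Table 1 (882)] -/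
theorem shapes_on_family_oneTwentySix_seven [Fact (Nat.Prime 7)]
    (χ : DirichletCharacter ℂ 7) (hχ : χ.IsQuadratic) (hprim : χ.IsPrimitive)
    (W : WeierstrassCurve ℚ) [W.IsElliptic] [W.IsGloballyMinimal] (D : ModularParametrizationData W 126)
    (hopt : ∀ z ∈ D.L.lattice, ∃ w ∈ periodLattice D.f, z = D.c * w)
    (W' : WeierstrassCurve ℚ) [W'.IsElliptic] [W'.IsGloballyMinimal] [NeZero (882 : ℕ)]
    (D' : ModularParametrizationData W' 882)
    (hf : ∀ n : ℕ, cuspCoeff D'.f n = χ n * cuspCoeff D.f n)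
    (hopt' : ∀ z ∈ D'.L.lattice, ∃ w ∈ periodLattice D'.f, z = D'.c * w) :
    |D'.maninConstant| = 1 ∧ ¬ (3 : ℤ) ∣ D'.maninConstant ∧ ¬ (7 : ℤ) ∣ D'.maninConstant :=
  have h1 := twistLevelManinOne_oneTwentySix (p := 7) (by norm_num) χ hχ hprim W D hopt
    (Or.inr (hasMultiplicativeReductionAtPrime_seven D)) W' 882 D' (by norm_num) (by norm_num) hf hopt'
  ⟨h1, not_dvd_of_abs_eq_one h1 (by decide), not_dvd_of_abs_eq_one h1 (by decide)⟩

/-- **C3 (and `5 ∤ c`) on `126 ⊗ χ₅` (level `3150 = 2·3²·5²·7`)**, the carrier good or multiplicative at `5`.  No printed fact.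
[cite: CremonaAlgorithms1997, Table 1 (3150)] -/
theorem shapes_on_family_oneTwentySix_five [Fact (Nat.Prime 5)]
    (χ : DirichletCharacter ℂ 5) (hχ : χ.IsQuadratic) (hprim : χ.IsPrimitive)
    (W : WeierstrassCurve ℚ) [W.IsElliptic] [W.IsGloballyMinimal] (D : ModularParametrizationData W 126)
    (hopt : ∀ z ∈ D.L.lattice, ∃ w ∈ periodLattice D.f, z = D.c * w)
    (hsemi : W.HasGoodReductionAtPrime 5 ∨ W.HasMultiplicativeReductionAtPrime 5)
    (W' : WeierstrassCurve ℚ) [W'.IsElliptic] [W'.IsGloballyMinimal] [NeZero (3150 : ℕ)]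
    (D' : ModularParametrizationData W' 3150)
    (hf : ∀ n : ℕ, cuspCoeff D'.f n = χ n * cuspCoeff D.f n)
    (hopt' : ∀ z ∈ D'.L.lattice, ∃ w ∈ periodLattice D'.f, z = D'.c * w) :
    |D'.maninConstant| = 1 ∧ ¬ (3 : ℤ) ∣ D'.maninConstant ∧ ¬ (5 : ℤ) ∣ D'.maninConstant :=
  have h1 := twistLevelManinOne_oneTwentySix (p := 5) (by norm_num) χ hχ hprim W D hopt hsemi W' 3150 D'
    (by norm_num) (by norm_num) hf hopt'
  ⟨h1, not_dvd_of_abs_eq_one h1 (by decide), not_dvd_of_abs_eq_one h1 (by decide)⟩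

end Summit.BirchSwinnertonDyer.BirchSwinnertonDyer.Theorems.ManinLocalTwoThree.TwistRootsOneTwentySix

end
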